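/-
Copyright: the b2b-balaban T⁴-continuum CRUX team, row NE7b OWNER lineage `t4-ne7b-p1` (gen 141). Project licence.
-/
import Summits.QuantumFields.BalabanUV.T4Continuum.Spine.NE7b.SupWhitenedTwoPointEntries
import Summits.QuantumFields.BalabanUV.T4Continuum.Spine.NE7b.SupWhitenedThirdCumulantEntry
import Summits.QuantumFields.BalabanUV.T4Continuum.Spine.NE7b.SupBlockThirdKernelAverage

/-!
# THE ENTRYWISE, BACKGROUND-FREE MAJORANT OF THE FLUCTUATION STEP'S THIRD DERIVATIVE, GENERAL `Γ = AAᵀ` (SCOPING (d13)(1), third file).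
# The class map needs the output's third derivative `T(ψ) = D³W(ψ)` back in the INPUT format `|U‴(φ)[e_u,e_x,e_y]| ≤ K3_{xyu}` for ALL
# backgrounds `φ`; (475) gave only the row letter.  By (472)'s centred display, (474)'s split and the ENTRY bounds of the five pieces —
# the average (`|⟨U‴⟩_{xyz}| ≤ K3_{yzx}`, §1), the three two-point covariances ((477), any admissible `D`) and the cumulant ((478), tree decay) —
#   `|T(ψ)[e_x,e_y,e_z]| ≤ M_{xyz} := K3_{yzx} + E_D(g^{xz},b^y) + E_D(g^{xy},b^z) + E_D(b^x,g^{yz}) + 4√(m₄K)∕(ρ_{xy}ρ_{xz})`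
# for EVERY background `ψ`, where `E_D(a,b) = Σ_w(Dᵀa)_w(Dᵀb)_w∕(1−lamA)`, `g^{xy}_w = Σ_u|A_{uw}|K3_{xyu}`, `b^v_w = Σ_u|A_{uw}|Hk_{vu}`,
# `m₄ = 5κ₂⁴γ_op²∕(1−λγ_op)²`, `K = αθ·dθ·(βθ·dθ′)∕(1−lamA)` — `M` does NOT depend on `ψ`: so `K3⁺_{xyu} := M_{uxy}` IS an input-format majorant
# of the output, and its letters are the three fixed-slot double sums of `M` (next files) (row NE7b, node U5c; (472), (474), (477), (478),
# (437), (470), (458) BY NAME; [folklore])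

Cell `pub-balaban`, sub-cell `t4`, spine estimate NE7b (`T4WeightBudget.RelWeightBound`; the cell's OWN estimate — NOT PRINTED in
[Bałaban 1983–89], NOT PROVED).  Crux-route work under `Spine/NE7b/` by the row OWNER (`t4-ne7b-p1` gen 141, file (479)) under FREEZE
(0)'s crux-prover clause; NOTHING of Bałaban's is named as a Lean object, valued or asserted; no `T4Continuum/Support` leaf typed; no
`def`, no notation (`T(ψ)` and `M` WRITTEN OUT); zero `sorry`.  Imports (BY NAME): the OWNER's (477) `…SupWhitenedTwoPointEntries`
(`hessgrad_cov_entry`, `gradhess_cov_entry`), (478) `…SupWhitenedThirdCumulantEntry` (`whitened_third_cumulant_entry`; through it (475), (474)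
`centred_split`, (472) `hessW_deriv_apply_centred`, (458) `posSemidef_AAT`), (470) `…SupBlockThirdKernelAverage` (`integrable_weighted_third_entry`;
through it (437) `rowsum_of_weighted_average`, (410) `block_Z_pos`, (401) `integrable_exp_neg_block`).

WHAT IS PROVED ([folklore]):
* §1 (general `Γ ⪰ 0`) `tilted_third_average_entry` (`|Z⁻¹∫e^{−U}U‴(ω+ψ)[e_x,e_y,e_z]dN(0,Γ)| ≤ K3_{yzx}`).
* §2 THE END **`whitened_third_kernel_entry`** (the display); §3 toy.

HONEST (what this is NOT).  An entrywise majorant; its three fixed-slot letters, the order-2 companion ((459)) and the packaged class map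
are the next files; `D`'s letters and the weights are hypotheses ((453)∕(462)∕(476)); scalar skeleton ((A3), NC-NE7b-α UNRULED); nothing of
Bałaban's asserted.  BY-NAME EFFECT ON THE WALL: NONE.  NE7b NOT PRINTED ∕ NOT PROVED; spine PROVED 0∕9; rung (B)+1 — the programme's
measures remain FINITE-torus statements; NOT the mass gap, NOT Clay.  HONEST DEPENDENCY: continuum YM on T⁴ ⇐ BetaPertH ∧ nine spine
estimates (0∕9 proved); BetaPertH ⇐ (D1) ∧ (D4) ∧ CAP+tail; G-an2-4 gates asym, D1 and NE2∕3∕4.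
-/

set_option autoImplicit false
set_option maxSynthPendingDepth 3

noncomputable section

namespace Summit.QuantumFields.BalabanUV.T4Continuum.NE7b.SupWhitenedThirdKernelEntry

open MeasureTheory ProbabilityTheory Finset Real Matrix
open scoped BigOperators Matrix
open SupEffectiveActionDerivative (mul_opBound_le_of_le)
open SupBlockEffectiveActionDerivative (integrable_exp_neg_block)
open SupBlockDressedStep (block_Z_pos)
open SupBlockHessianKernelAverage (rowsum_of_weighted_average)
open SupBlockThirdKernelAverage (integrable_weighted_third_entry)
open SupWhitenedMomentLetters (posSemidef_AAT)
open SupBlockThirdCentredGeneral (hessW_deriv_apply_centred)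
open SupBlockThirdCentredSplit (centred_split)
open SupWhitenedTwoPointEntries (hessgrad_cov_entry gradhess_cov_entry)
open SupWhitenedThirdCumulantEntry (whitened_third_cumulant_entry)

variable {ι κ : Type} [Fintype ι] [DecidableEq ι] [Fintype κ] [DecidableEq κ]

/-! ## §1. The average entry (general `Γ ⪰ 0`) -/

section Average

variable {Γ : Matrix ι ι ℝ} {γop : ℝ} {U : EuclideanSpace ℝ ι → ℝ} {U' : EuclideanSpace ℝ ι → EuclideanSpace ℝ ι →L[ℝ] ℝ}
  {U₃ : EuclideanSpace ℝ ι → EuclideanSpace ℝ ι →L[ℝ] EuclideanSpace ℝ ι →L[ℝ] EuclideanSpace ℝ ι →L[ℝ] ℝ} {K3 : ι → ι → ι → ℝ} {κ₀ κ₃ τ δ θp : ℝ}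

omit [Fintype κ] [DecidableEq κ] in
/-- **THE AVERAGE ENTRY**: `|Z⁻¹∫e^{−U(ω+ψ)}U‴(ω+ψ)[e_x,e_y,e_z]dN(0,Γ)(ω)| ≤ K3_{yzx}` for an entrywise majorant `|U‴(φ)[e_u,e_x,e_y]| ≤ K3_{xyu}`
(a weighted average is at most the sup; (437) on the one-point index). [folklore] -/
theorem tilted_third_average_entry (hΓ : Γ.PosSemidef) (hΓop : (γop • (1 : Matrix ι ι ℝ) - Γ).PosSemidef) (Y : Finset ι)
    (hUd : ∀ φ : EuclideanSpace ℝ ι, HasFDerivAt U (U' φ) φ) (hU₃c : Continuous U₃) (hκ₀ : 0 ≤ κ₀) (hτ : 0 < τ) (hδ : 0 < δ) (hθ0 : 0 < θp)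
    (hθ1 : θp < 1) (hκθ : (2 * κ₀ * (1 + τ) + 4 * δ) * γop ≤ θp) (hstab : ∀ φ : EuclideanSpace ℝ ι, -(κ₀ * ∑ x ∈ Y, φ x ^ 2) ≤ U φ)
    (hU₃b : ∀ φ : EuclideanSpace ℝ ι, ‖U₃ φ‖ ≤ κ₃)
    (hK3 : ∀ (φ : EuclideanSpace ℝ ι) (u x y : ι),
      |U₃ φ (EuclideanSpace.single u (1 : ℝ)) (EuclideanSpace.single x (1 : ℝ)) (EuclideanSpace.single y (1 : ℝ))| ≤ K3 x y u)
    (ψ : EuclideanSpace ℝ ι) (x y z : ι) :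
    |(∫ ω : EuclideanSpace ℝ ι, exp (-U (ω + ψ)) ∂(multivariateGaussian 0 Γ))⁻¹ * (∫ ω : EuclideanSpace ℝ ι, exp (-U (ω + ψ)) * U₃ (ω + ψ)
        (EuclideanSpace.single x (1 : ℝ)) (EuclideanSpace.single y (1 : ℝ)) (EuclideanSpace.single z (1 : ℝ)) ∂(multivariateGaussian 0 Γ))| ≤ K3 y z
        x := by
  have hUc : Continuous U := continuous_iff_continuousAt.2 fun φ => (hUd φ).continuousAt
  have hκθ₀ : 2 * κ₀ * (1 + τ) * γop ≤ θp := mul_opBound_le_of_le (by positivity) (by linarith) hθ0.le hκθ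
  have hI := integrable_exp_neg_block hΓ hΓop Y hUc.measurable hκ₀ hτ hθ1 hκθ₀ hstab ψ
  have hZ := block_Z_pos hΓ hΓop Y hUd hκ₀ hτ hδ hθ0 hθ1 hκθ hstab ψ
  have hint := integrable_weighted_third_entry hΓ hΓop Y hUd hU₃c hκ₀ hτ hδ hθ0 hθ1 hκθ hstab hU₃b ψ x y z
  have h := rowsum_of_weighted_average (multivariateGaussian 0 Γ) (fun ω : EuclideanSpace ℝ ι => exp (-U (ω + ψ)))
    (fun (ω : EuclideanSpace ℝ ι) (_ : Unit) (_ : Unit) => U₃ (ω + ψ) (EuclideanSpace.single x (1 : ℝ)) (EuclideanSpace.single y (1 : ℝ))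
        (EuclideanSpace.single z (1 : ℝ)))
    (fun ω => (exp_pos _).le) hI hZ (fun _ _ => hint) (fun ω _ => by simpa using hK3 (ω + ψ) x y z) ()
  simpa using h

end Average

/-! ## §2. THE END: the entrywise majorant for `Γ = AAᵀ` -/

section TheEnd

variable {U : EuclideanSpace ℝ ι → ℝ} {U' : EuclideanSpace ℝ ι → EuclideanSpace ℝ ι →L[ℝ] ℝ}
  {U'' : EuclideanSpace ℝ ι → EuclideanSpace ℝ ι →L[ℝ] EuclideanSpace ℝ ι →L[ℝ] ℝ}
  {U₃ : EuclideanSpace ℝ ι → EuclideanSpace ℝ ι →L[ℝ] EuclideanSpace ℝ ι →L[ℝ] EuclideanSpace ℝ ι →L[ℝ] ℝ} {Hk : ι → ι → ℝ} {K3 : ι → ι → ι → ℝ}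
  {A : Matrix ι κ ℝ} {D : κ → κ → ℝ} {γop κ₀ κ₁ κ₂ κ₃ a τ δ θp lam lamA αr αc hr γ dθ dθ' αθ βθ : ℝ} {θ : κ → κ → ℝ} {σ : ι → κ → ℝ}
  {ρ : ι → ι → ℝ}

/-- **THE END — THE ENTRYWISE MAJORANT OF `D³W`, GENERAL `Γ = AAᵀ`, UNIFORM IN THE BACKGROUND.**  Under the `C³` block class letters, the
majorants `Hk ≥ 0` (rows `hr`) and `K3`, the factor's letters `αr, αc, lamA < 1`, the smallness `αc·hr·αr∕(1−lamA) ≤ γ < 1`, the two regulators,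
the secant letter `λγ_op < 1`, an admissible `D ≥ 0` (`δ + D·C ≤ D`) with weighted letters `dθ, dθ′` against a sampler weight `θ ≥ 0`, a
compatible cross weight `σ ≥ 0`, a symmetric submultiplicative site weight `ρ ≥ 1` with `ρ⁸ ≤ σσ`, and the weighted profiles `αθ, βθ`:
`|T(ψ)[e_x,e_y,e_z]| ≤ K3_{yzx} + E_D(g^{xz},b^y) + E_D(g^{xy},b^z) + E_D(b^x,g^{yz}) + 4√(m₄K)∕(ρ_{xy}ρ_{xz})` for every `ψ, x, y, z`. [folklore] -/
theorem whitened_third_kernel_entry [Nonempty κ] (hΓop : (γop • (1 : Matrix ι ι ℝ) - A * Aᵀ).PosSemidef) (Y : Finset ι)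
    (hUd : ∀ φ : EuclideanSpace ℝ ι, HasFDerivAt U (U' φ) φ) (hU'd : ∀ φ : EuclideanSpace ℝ ι, HasFDerivAt U' (U'' φ) φ)
    (hU''d : ∀ φ : EuclideanSpace ℝ ι, HasFDerivAt U'' (U₃ φ) φ) (hU₃c : Continuous U₃) (hκ₀ : 0 ≤ κ₀) (hκ₁ : 0 ≤ κ₁) (ha : 0 ≤ a) (hκ₂ : 0 ≤ κ₂)
        (hκ₃ : 0 ≤ κ₃)
    (hτ : 0 < τ) (hδ : 0 < δ) (hθ0 : 0 < θp) (hθ1 : θp < 1) (hκθ : (2 * κ₀ * (1 + τ) + 4 * δ) * γop ≤ θp) (hκθw : 2 * κ₀ * (1 + τ) * γop + 4 * δ ≤ θp)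
    (hstab : ∀ φ : EuclideanSpace ℝ ι, -(κ₀ * ∑ x ∈ Y, φ x ^ 2) ≤ U φ)
    (hU'b : ∀ φ : EuclideanSpace ℝ ι, ‖U' φ‖ ≤ κ₁ * (a + ∑ x ∈ Y, φ x ^ 2)) (hU''b : ∀ φ : EuclideanSpace ℝ ι, ‖U'' φ‖ ≤ κ₂)
    (hU₃b : ∀ φ : EuclideanSpace ℝ ι, ‖U₃ φ‖ ≤ κ₃) (hlam : 0 ≤ lam)
    (hUsec : ∀ s : ℝ, 0 ≤ s → s ≤ 1 → ∀ a b : EuclideanSpace ℝ ι,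
      U ((1 - s) • a + s • b) - lam / 2 * (s * (1 - s)) * ∑ i, (a i - b i) ^ 2 ≤ (1 - s) * U a + s * U b)
    (hρg : lam * γop < 1)
    -- the majorants and their letters
    (hHk : ∀ (φ : EuclideanSpace ℝ ι) (x z : ι), |U'' φ (EuclideanSpace.single z (1 : ℝ)) (EuclideanSpace.single x (1 : ℝ))| ≤ Hk x z)
    (hHk0 : ∀ v u, 0 ≤ Hk v u)
    (hK3 : ∀ (φ : EuclideanSpace ℝ ι) (u x y : ι),
      |U₃ φ (EuclideanSpace.single u (1 : ℝ)) (EuclideanSpace.single x (1 : ℝ)) (EuclideanSpace.single y (1 : ℝ))| ≤ K3 x y u)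
    (ψ : EuclideanSpace ℝ ι) (hαr : ∀ u, ∑ w, |A u w| ≤ αr) (hαc : ∀ w, ∑ u, |A u w| ≤ αc) (hhr : ∀ v, ∑ u, Hk v u ≤ hr)
    (hlamA : ∀ x : κ, ∑ u, ∑ v, |A u x| * |A v x| * Hk v u ≤ lamA) (hlamA1 : lamA < 1) (hγ : αc * hr * αr / (1 - lamA) ≤ γ) (hγ1 : γ < 1)
    -- the admissible `D`, its weighted letters, the weights and the weighted profiles
    (hD : ∀ x y, 0 ≤ D x y)
    (hDC : ∀ x y, (if x = y then (1 : ℝ) else 0) + ∑ z, D x z * ((if y = z then 0 else ∑ u, ∑ v, |A u y| * |A v z| * Hk v u) / (1 - lamA)) ≤ D x y)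
    (hθnn : ∀ z w, 0 ≤ θ z w) (hDr : ∀ z, ∑ w, D z w * θ z w ≤ dθ) (hdθ : 0 ≤ dθ) (hDc : ∀ w, ∑ z, D z w * θ z w ≤ dθ') (hdθ' : 0 ≤ dθ')
    (hσ0 : ∀ x w, 0 ≤ σ x w) (hσθ : ∀ x z w, σ x w ≤ σ x z * θ z w)
    (hρ1 : ∀ x y, 1 ≤ ρ x y) (hρsymm : ∀ x y, ρ x y = ρ y x) (hρmul : ∀ x y z, ρ x z ≤ ρ x y * ρ y z) (hρσ : ∀ x y w, ρ x y ^ 8 ≤ σ x w * σ y w)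
    (haσ : ∀ v : ι, ∑ w, (∑ u, |A u w| * Hk v u) * σ v w ≤ αθ) (hβ : 0 ≤ βθ) (haσ' : ∀ (v : ι) (w : κ), (∑ u, |A u w| * Hk v u) * σ v w ≤ βθ)
    (x y z : ι) :
    |(((∫ ω : EuclideanSpace ℝ ι, exp (-U (ω + ψ)) ∂(multivariateGaussian 0 (A * Aᵀ)))⁻¹ • (∫ ω : EuclideanSpace ℝ ι, (exp (-U (ω + ψ)) • (U₃ (ω + ψ)
        -
        (((ContinuousLinearMap.smulRightL ℝ (EuclideanSpace ℝ ι) (EuclideanSpace ℝ ι →L[ℝ] ℝ)) (U' (ω + ψ))).comp (U'' (ω + ψ)) +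
            (((ContinuousLinearMap.smulRightL ℝ
        (EuclideanSpace ℝ ι) (EuclideanSpace ℝ ι →L[ℝ] ℝ))).comp (U'' (ω + ψ))).flip (U' (ω + ψ)))) + (exp (-U (ω + ψ)) • -U' (ω + ψ)).smulRight (U''
            (ω + ψ) - (U' (ω +
        ψ)).smulRight (U' (ω + ψ)))) ∂(multivariateGaussian 0 (A * Aᵀ))) + ((-((∫ ω : EuclideanSpace ℝ ι, exp (-U (ω + ψ)) ∂(multivariateGaussian 0
            (A * Aᵀ))) ^ 2)⁻¹) • -(∫ ω :
        EuclideanSpace ℝ ι, exp (-U (ω + ψ)) • U' (ω + ψ) ∂(multivariateGaussian 0 (A * Aᵀ)))).smulRight (∫ ω : EuclideanSpace ℝ ι, exp (-U (ω + ψ))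
            • (U'' (ω + ψ) - (U' (ω +
        ψ)).smulRight (U' (ω + ψ))) ∂(multivariateGaussian 0 (A * Aᵀ)))) + (((ContinuousLinearMap.smulRightL ℝ (EuclideanSpace ℝ ι) (EuclideanSpace ℝ
            ι →L[ℝ] ℝ)) (((∫ ω :
        EuclideanSpace ℝ ι, exp (-U (ω + ψ)) ∂(multivariateGaussian 0 (A * Aᵀ))) ^ 2)⁻¹ • (∫ ω : EuclideanSpace ℝ ι, exp (-U (ω + ψ)) • U' (ω + ψ)
            ∂(multivariateGaussian 0
        (A * Aᵀ))))).comp (∫ ω : EuclideanSpace ℝ ι, exp (-U (ω + ψ)) • (U'' (ω + ψ) - (U' (ω + ψ)).smulRight (U' (ω + ψ))) ∂(multivariateGaussian 0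
            (A * Aᵀ))) +
        (((ContinuousLinearMap.smulRightL ℝ (EuclideanSpace ℝ ι) (EuclideanSpace ℝ ι →L[ℝ] ℝ))).comp (((∫ ω : EuclideanSpace ℝ ι, exp (-U (ω + ψ))
            ∂(multivariateGaussian 0
        (A * Aᵀ))) ^ 2)⁻¹ • (∫ ω : EuclideanSpace ℝ ι, exp (-U (ω + ψ)) • (U'' (ω + ψ) - (U' (ω + ψ)).smulRight (U' (ω + ψ))) ∂(multivariateGaussian
            0 (A * Aᵀ))) + ((-2 / (∫ ω :
        EuclideanSpace ℝ ι, exp (-U (ω + ψ)) ∂(multivariateGaussian 0 (A * Aᵀ))) ^ 3) • -(∫ ω : EuclideanSpace ℝ ι, exp (-U (ω + ψ)) • U' (ω + ψ)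
            ∂(multivariateGaussian 0
        (A * Aᵀ)))).smulRight (∫ ω : EuclideanSpace ℝ ι, exp (-U (ω + ψ)) • U' (ω + ψ) ∂(multivariateGaussian 0 (A * Aᵀ))))).flip (∫ ω :
            EuclideanSpace ℝ ι, exp (-U (ω + ψ)) • U' (ω
        + ψ) ∂(multivariateGaussian 0 (A * Aᵀ))))) (EuclideanSpace.single x (1 : ℝ)) (EuclideanSpace.single y (1 : ℝ)) (EuclideanSpace.single z (1 :
            ℝ))| ≤
      K3 y z x + ∑ w, (∑ z', D z' w * ∑ u, |A u z'| * K3 x z u) * (∑ z', D z' w * ∑ u, |A u z'| * Hk y u) / (1 - lamA) + ∑ w, (∑ z', D z' w * ∑ u, |A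
          u z'| * K3 x y u) * (∑ z', D z' w * ∑ u, |A u z'| * Hk z u) / (1 - lamA) + ∑ w, (∑ z', D z' w * ∑ u, |A u z'| * Hk x u) * (∑ z', D z' w * ∑
          u, |A u z'| * K3 y z u) / (1 - lamA) + 4 * Real.sqrt (5 * (κ₂ ^ 4 * γop ^ 2) / (1 - lam * γop) ^ 2 * (αθ * dθ * (βθ * dθ') / (1 - lamA))) /
          (ρ x y * ρ x z) := by
  have hΓ : (A * Aᵀ).PosSemidef := posSemidef_AAT A
  have hU''c : Continuous U'' := continuous_iff_continuousAt.2 fun φ => (hU''d φ).continuousAt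
  have hκθ' : 2 * κ₀ * (1 + τ) * γop ≤ θp := mul_opBound_le_of_le (by positivity) (by linarith) hθ0.le hκθ
  -- the centred display and the five-piece split ((472), (474))
  rw [hessW_deriv_apply_centred hΓ hΓop Y hUd hU'd hU''d hU₃c hκ₀ hκ₁ ha hκ₂ hκ₃ hτ hδ hθ0 hθ1 hκθ hstab hU'b hU''b hU₃b ψ _ _ _,
    centred_split hΓ hΓop Y hUd hU'd hU''d hU₃c hκ₀ hκ₁ ha hτ hδ hθ0 hθ1 hκθ hstab hU'b hU''b hU₃b ψ _ _ _]
  -- the five entries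
  have h1 := tilted_third_average_entry hΓ hΓop Y hUd hU₃c hκ₀ hτ hδ hθ0 hθ1 hκθ hstab hU₃b hK3 ψ x y z
  have h2 := hessgrad_cov_entry hΓop Y hUd hU'd hU''d hHk hHk0 hK3 hκ₀ hτ hδ hθ1 hκθ' hκθw hstab ψ hαr hαc hhr hlamA hlamA1 hγ hγ1 hD hDC x z y
  have h3 := hessgrad_cov_entry hΓop Y hUd hU'd hU''d hHk hHk0 hK3 hκ₀ hτ hδ hθ1 hκθ' hκθw hstab ψ hαr hαc hhr hlamA hlamA1 hγ hγ1 hD hDC x y z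
  have h4 := gradhess_cov_entry hΓop Y hUd hU'd hU''d hHk hHk0 hK3 hκ₀ hτ hδ hθ1 hκθ' hκθw hstab ψ hαr hαc hhr hlamA hlamA1 hγ hγ1 hD hDC x y z
  have h5 := whitened_third_cumulant_entry hΓop Y hUd hU'd hU''c hκ₀ hκ₁ ha hτ hδ hθ0 hθ1 hκθ hκθw hstab hU'b hU''b hlam hUsec hρg hHk hHk0 ψ hαr hαc
      hhr
    hlamA hlamA1 hγ hγ1 hD hDC hθnn hDr hdθ hDc hdθ' hσ0 hσθ hρ1 hρsymm hρmul hρσ haσ hβ haσ' x y z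
  -- sub-additivity (`|a − b − c − d + e| ≤ Σ|·|` is the tree's `…TraceNormColdPressure.abs_sub_sub_sub_add_le`; inlined)
  have hsplit : ∀ a b c d e : ℝ, |a - b - c - d + e| ≤ |a| + |b| + |c| + |d| + |e| := fun a b c d e => by
    have e1 := abs_add_le (a - b - c - d) e
    have e2 := abs_sub (a - b - c) d
    have e3 := abs_sub (a - b) c
    have e4 := abs_sub a b
    linarith
  refine (hsplit _ _ _ _ _).trans ?_
  linarith [h1, h2, h3, h4, h5]

end TheEnd

/-! ## §3. Toy -/

/-- Toy (§1 in numbers: a weighted average of values `≤ 3` is `≤ 3`): `(1+1)⁻¹·(1·2 + 1·3) ≤ 3`. -/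
example : ((1 : ℝ) + 1)⁻¹ * (1 * 2 + 1 * 3) ≤ 3 := by norm_num

end Summit.QuantumFields.BalabanUV.T4Continuum.NE7b.SupWhitenedThirdKernelEntry

end
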